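import Literature.MathematicalPhysics.QuantumFieldTheory.Balaban1983to89.B15Prop1CarrierOnSU2BoxIneq19
import Literature.MathematicalPhysics.QuantumFieldTheory.Balaban1983to89.B15ShellGauge193Local

/-!
# `Balaban1983to89.B15Prop1CarrierOnSU2BoxExt193` — T. Bałaban, *Large field renormalization. I. The basic step of the 𝐑 operation*,
Commun. Math. Phys. **122** (1989) 175–202 [Balaban1989LargeFieldI] («[IV]»), **Proposition 1** p. 194 (proof [Balaban1989LargeFieldII]
pp. 357–359) AT THE CARRIER OF RECORD — `SU(2)`, parallelepipeds, print's `x₁`-axial `G₀`, the printed chart, the slice coordinates,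
(m1) from (1.7) — WITH THE EXTENSION LETTERS (ℓ2) DISCHARGED: the extension of the datum `V_k` into `Λ` IS the p. 193 shell-gauge
extension `extend (pts k Λ) (shellGauge V_k lo hi) V_k` of `B15Extension193` ∕ `B15ShellGauge193` (lit-balaban r12), and its three
letters `hext0` ∕ `hextZ` ∕ `hextΛ` of dag-n12-c's `B15Prop1CarrierOnSU2BoxIneq19.prop1Printed_lfVarOn_su2_box_G0_of_17` (p473804) are
theorems (`B15ShellGauge193Local.extend_mem_extSet` ∕ `dist1_plaqHol_extend_shellGauge_le`, `d ≥ 3`).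

statement-level skeleton of published theorems with citation tags; proofs where landed; nothing here is a claim about
the Yang–Mills mass gap

Cell pub-ymgap, HUMAN RULING D-0062 (Track A full width), seat `pub-ymgap-dag-n12-c` (R134 acceleration seat (a), strategy s1 of DAG
node N12 = [B15]; generation g3, second product).  PDFs held: `paper:balaban1989-cmp122-large-field-i` (journal page = PDF page + 174),
`paper:balaban1989-cmp122-large-field-ii` (journal page = PDF page + 354).

THE PRINT ([IV] p. 193 → p. 194): *"… we get a configuration V_k defined on the whole domain, equal to the given one on Z∩Λ^c, and
satisfying the regularity condition |∂V_k − 1| < O(1)M²ε."* — *"Let us consider a configuration V_k satisfying the above regularity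
condition, i.e., |V_k(∂p′) − 1| < ε for p′ ⊂ (Z∩Λ^c)^{(k)}, and let us assume that it is extended to the lattice Λ^{(k)} as described
above."*; [LF-II] p. 359 l. 2–3: *"For simplicity of the argument let us take an extension of V_k to the domain Λ, as in [18]. We fix such
an extension"*.

WHAT THIS FILE PROVES (theorems only; Mathlib + the two imports; no `sorry`, no definition, no `… : Prop` fact; axioms standard).
§1 `ext193_bookkeeping` — the constant: `n + 1 ≤ 100M` (print p. 192: *"contained in a cube of the size 100M"*) gives
   `12d(n + 2)² ≤ 122412·d·M²`, so `bx := 122412 d` serves in `hbxM`.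
§2 **`prop1Printed_lfVarOn_su2_box_G0_of_17_ext193`** — `B15.Prop1Printed (lfVarOn su2Chart I)` for box instances at `SU(2)` EXACTLY as
   `prop1Printed_lfVarOn_su2_box_G0_of_17`, except that the extension `ext i V_k` is PINNED (`hext`) to the p. 193 extension and the three
   letters `hext0` (*"equal to the given one on Z∩Λ^c"*), `hextZ` (*"|∂V_k − 1| < O(1)M²ε"* on `Z^{(k)}`), `hextΛ` (the same on the
   plaquettes meeting `Λ^{(k)}`) are NO LONGER HYPOTHESES; in their place: `3 ≤ d`, `lo ≤ hi` (a genuine parallelepiped) and the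
   constant bookkeeping `hbxM : 12d(n_i + 2)² ≤ bx·M_i²`.
§3 `thresholds_exist` — the three thresholds `hN'` ∕ `hδ` ∕ `he1` (*"ε sufficiently small"*, the domain constant `a₁` of (1.77))
   are JOINTLY SATISFIABLE for every radius `r > 0` and all sizes (explicit `δc`, `a₁`, `eD`): non-vacuity of the threshold part.

HONEST SCOPE.  What remains displayed after this file: (1.7) (the p. 357 perturbation letter), (m2)–(m5), (c3) (the expansion pieces
OF RECORD — NODE 00; now stated AT the p. 193 extension), (c3″) ((181) covariance at print's instance), (x), thresholds and constant
bookkeeping.  `d ≥ 3` (print: `d = 3, 4`; in `d = 2` the extension lemma is false, r12's reading note G-B15-02).  Count-neutral; NOT a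
discharge of N12; NOT summit progress.
-/

noncomputable section

open Set Finset
open scoped RealInnerProductSpace Real

namespace Literature.MathematicalPhysics.QuantumFieldTheory.Balaban1983to89.B15Prop1CarrierOnSU2BoxExt193

open B15DeterminingSets GaugeField B16Sect1Backgrounds B15Prop1Carrier B8Eq17ClassAkV1
open B15Prop1CarrierOnSU2Box B15Prop1SliceIneq18 B15Prop1CarrierOnSU2BoxIneq19
open T4CubeChartGnomonic (SU2)
open B15Prop1ChartSU2 (su2Chart)
open B15Prop1SliceCoordinates (GaugeSlice ιA freeBonds)
open T4AxialGaugeSmallField (castSite boxPlaqs)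
open B7Prop1Explicit (e e_apply)
open B6BondElimination (unitVec unitVec_apply)
open B6TreeGaugePoincare (curl)
open B16Eq18Proof (box mem_box)
open B15Extension193 (extend)
open B15ShellGauge193 (shellGauge)
open B15ShellGauge193Local (extend_mem_extSet dist1_plaqHol_extend_shellGauge_le)

variable {P : Params}

/-! ## §1 The constant -/

/-- **CONSTANT BOOKKEEPING for `hbxM`**: print's `Λ` is *"a rectangular parallelepiped contained in a cube of the size 100M"* (p. 192),
so with `n + 1 ≤ 100M` sites per direction `12d(n + 2)² ≤ 12·101²·d·M² = 122412·d·M²` — the printed `O(1)M²` of p. 193 with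
`O(1) ↤ 122412 d`. [cite: Balaban1989LargeFieldI, (1.73) p.192, p.193] -/
theorem ext193_bookkeeping {d n : ℕ} {M : ℝ} (hM : 1 ≤ M) (hn : (n : ℝ) + 1 ≤ 100 * M) :
    12 * (d : ℝ) * ((n : ℝ) + 2) ^ 2 ≤ 122412 * d * M ^ 2 := by
  have hd : (0 : ℝ) ≤ d := Nat.cast_nonneg _
  have h1 : (n : ℝ) + 2 ≤ 101 * M := by linarith
  have h0 : (0 : ℝ) ≤ (n : ℝ) + 2 := by positivity
  have h2 : ((n : ℝ) + 2) ^ 2 ≤ (101 * M) ^ 2 := pow_le_pow_left₀ h0 h1 2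
  nlinarith [mul_le_mul_of_nonneg_left h2 (by positivity : (0 : ℝ) ≤ 12 * (d : ℝ))]

/-! ## §2 Proposition 1 at the carrier of record with the p. 193 extension: (ℓ2) discharged -/

/-- **PROPOSITION 1 [IV] AT THE CARRIER OF RECORD — `SU(2)`, BOXES, `T = G₀`, PRINTED CHART, SLICE COORDINATES, (m1) FROM (1.7) —
WITH THE EXTENSION OF `V_k` INTO `Λ` BEING THE p. 193 SHELL-GAUGE EXTENSION AND ITS LETTERS (ℓ2) PROVED.**  As
`B15Prop1CarrierOnSU2BoxIneq19.prop1Printed_lfVarOn_su2_box_G0_of_17` with `ext i V_k = extend (pts k Λ) (shellGauge V_k lo hi) V_k`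
(`hext`); the hypotheses `hext0`, `hextZ`, `hextΛ` of that theorem are supplied by `B15ShellGauge193Local.extend_mem_extSet` and
`B15ShellGauge193Local.dist1_plaqHol_extend_shellGauge_le` (every plaquette of `Z^{(k)}` and every plaquette meeting `Λ^{(k)}` of the
extension within `12d(n + 2)²ε ≤ bx·M²ε` of `1` under `lfVarOn`'s regularity, `d ≥ 3`, no threshold). [cite: Balaban1989LargeFieldI,
p.193, Prop. 1 (1.77)–(1.78) p.194; Balaban1989LargeFieldII, (1.7)–(1.9) p.358, pp.358–359] -/
theorem prop1Printed_lfVarOn_su2_box_G0_of_17_ext193 (hd3 : 3 ≤ P.d) (h0 : 0 < P.d) {ι : Type} (I : ι → InstOn P SU2)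
    [∀ i, DecidableEq (PBond P (I i).k)]
    (T : ∀ i, Finset (PBond P (I i).k))
    {F : ι → Type*} [∀ i, NormedAddCommGroup (F i)] [∀ i, InnerProductSpace ℝ (F i)]
    (H : ∀ i, GaugeField P (I i).k SU2 →
      (GaugeSlice (pts (I i).k (I i).Λ) (T i) (EuclideanSpace ℝ (Fin 3)) →ₗ[ℝ] F i))
    (Hst : ∀ i, GaugeField P (I i).k SU2 →
      (F i →ₗ[ℝ] GaugeSlice (pts (I i).k (I i).Λ) (T i) (EuclideanSpace ℝ (Fin 3))))
    (hadj : ∀ i Vk (x : GaugeSlice (pts (I i).k (I i).Λ) (T i) (EuclideanSpace ℝ (Fin 3))) (y : F i),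
      ⟪H i Vk x, y⟫ = ⟪x, Hst i Vk y⟫)
    (Δ₁ : ∀ i, GaugeField P (I i).k SU2 → (F i →ₗ[ℝ] F i)) (dV : ∀ i, GaugeField P (I i).k SU2 → F i → F i)
    (J : ∀ i, GaugeField P (I i).k SU2 → F i)
    (lo hi : ι → Fin P.d → ℤ) (n : ι → ℕ) (hn : ∀ i κ, hi i κ ≤ lo i κ + n i) (hN : ∀ i, n i + 2 < P.sitesPerDir (I i).k)
    (hbox : ∀ i, pts (I i).k (I i).Λ = (castSite '' Set.Icc (lo i) (hi i) : Set (Site P (I i).k)))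
    (hZ : ∀ i, (boxPlaqs (lo i - 1) (hi i + 1) : Set (Plaq P (I i).k)) ⊆ plaqsInside (pts (I i).k (I i).Z))
    (hTG0 : ∀ i, T i = (box (fun κ => (hi i κ - lo i κ + 1).toNat) (lo i)).image fun x =>
      (⟨castSite (x - unitVec ⟨0, h0⟩), ⟨0, h0⟩⟩ : PBond P (I i).k))
    (hN5 : ∀ i κ, ((hi i κ - lo i κ + 1).toNat : ℤ) + 5 < P.sitesPerDir (I i).k)
    (K : ι → ℕ) (hK1 : ∀ i, 1 ≤ K i) (hKn : ∀ i κ, (hi i κ - lo i κ + 1).toNat ≤ K i)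
    (ext : ∀ i, GaugeField P (I i).k SU2 → GaugeField P (I i).k SU2)
    -- (ℓ2) REPLACED: the extension is r12's p. 193 shell-gauge extension, `Λ` non-degenerate, constant bookkeeping `hbxM`
    (hext : ∀ i Vk, ext i Vk = extend (pts (I i).k (I i).Λ) (shellGauge Vk (lo i) (hi i)) Vk)
    (hlohi : ∀ i, lo i ≤ hi i)
    {γ γ₀ h₁ hst cJ bx : ℝ} (hγ : 0 < γ) (hγ₀ : 0 ≤ γ₀) (hh₁ : 0 ≤ h₁) (hhst : 0 ≤ hst) (hcJ : 0 ≤ cJ) (hbx : 0 ≤ bx)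
    (hbxM : ∀ i, 12 * (P.d : ℝ) * ((n i : ℝ) + 2) ^ 2 ≤ bx * (I i).M ^ 2)
    {ℓ ρ r eA eD a₁ δc Cerr : ι → ℝ} (hℓ : ∀ i, 0 ≤ ℓ i) (hr : ∀ i, 0 < r i) (heA : ∀ i, 0 < eA i) (heD : ∀ i, 0 < eD i)
    (hδc : ∀ i, 0 < δc i) (ha₁ : ∀ i, 0 ≤ a₁ i) (hM : ∀ i, 1 ≤ (I i).M)
    -- (m1) REPLACED by the (1.7) letter, the smallness and the constant bookkeeping
    (h17 : ∀ i Vk (X : GaugeSlice (pts (I i).k (I i).Λ) (T i) (EuclideanSpace ℝ (Fin 3))),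
      γ₀ * (∑ z ∈ box (fun κ => (hi i κ - lo i κ + 1).toNat + 3) (fun κ => lo i κ - 2), ∑ μ : Fin P.d, ∑ a : Fin 3,
          curl (fun b => ιA (pts (I i).k (I i).Λ) (T i) X (⟨castSite b.1, b.2⟩ : PBond P (I i).k) a) z ⟨0, h0⟩ μ ^ 2) -
        Cerr i * ‖X‖ ^ 2 ≤ ⟪H i Vk X, Δ₁ i Vk (H i Vk X)⟫)
    (hsm : ∀ i, Cerr i ≤ γ₀ / (2 * (3 * (K i : ℝ) ^ 2 + 2 * (K i : ℝ) ^ 4)))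
    (hγle : ∀ i, γ / (I i).M ^ 5 ≤ γ₀ / (2 * (3 * (K i : ℝ) ^ 2 + 2 * (K i : ℝ) ^ 4)))
    (hH : ∀ i Vk x, ‖H i Vk x‖ ≤ h₁ * ‖x‖) (hHst : ∀ i Vk z, ‖Hst i Vk z‖ ≤ hst * ‖z‖)
    (hdV0 : ∀ i Vk, dV i Vk 0 = 0)
    (hdV : ∀ i Vk (u v : F i), ‖u‖ ≤ ρ i → ‖v‖ ≤ ρ i → ‖dV i Vk u - dV i Vk v‖ ≤ ℓ i * ‖u - v‖)
    (hρ : ∀ i, h₁ * r i ≤ ρ i) (hsmall : ∀ i, (I i).M ^ 5 / γ * hst * ℓ i * h₁ ≤ 1 / 2)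
    (hA : ∀ i Vk (X δ : GaugeSlice (pts (I i).k (I i).Λ) (T i) (EuclideanSpace ℝ (Fin 3))),
      HasDerivAt (fun s : ℝ => (I i).f (expMul su2Chart (ιA (pts (I i).k (I i).Λ) (T i) (X + s • δ)) (ext i Vk)))
      (⟪δ, Hst i Vk (J i Vk)⟫ + ⟪δ, Hst i Vk (Δ₁ i Vk (H i Vk X))⟫ + ⟪δ, Hst i Vk (dV i Vk (H i Vk X))⟫) 0)
    (hJ : ∀ i ε Vk, 0 < ε → (lfVarOn su2Chart I).Regular i ε Vk → ‖J i Vk‖ ≤ cJ * ε)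
    (hc3 : ∀ i Vk (B : GaugeSlice (pts (I i).k (I i).Λ) (T i) (EuclideanSpace ℝ (Fin 3))), ‖B‖ ≤ r i →
      (IsCriticalPt su2Chart (bondsOf (pts (I i).k (I i).Λ)) (I i).f
          (expMul su2Chart (ιA (pts (I i).k (I i).Λ) (T i) B) (ext i Vk)) ↔
        ∀ δB : GaugeSlice (pts (I i).k (I i).Λ) (T i) (EuclideanSpace ℝ (Fin 3)),
          ⟪δB, Hst i Vk (J i Vk)⟫ + ⟪δB, Hst i Vk (Δ₁ i Vk (H i Vk B))⟫ + ⟪δB, Hst i Vk (dV i Vk (H i Vk B))⟫ = 0))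
    (hc3'' : ∀ i (u : GaugeTransf P (I i).k SU2) (V : GaugeField P (I i).k SU2), IsGaugeOn (pts (I i).k (I i).Λ) u →
      (I i).f (gaugeAct u V) = (I i).f V)
    (hAn : ∀ i ε Vk, 0 < ε → ε ≤ eA i → (lfVarOn su2Chart I).Regular i ε Vk → (I i).An ε Vk)
    (hdom : ∀ i, (I i).dom = domReg (I i).Z (I i).k (a₁ i))
    -- thresholds (`N i = √|free bonds|`)
    (hN' : ∀ i, Real.sqrt (freeBonds (pts (I i).k (I i).Λ) (T i)).card * (π / 2 * δc i) ≤ r i)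
    (hδ : ∀ i ε, 0 < ε → ε ≤ eD i →
      ((n i : ℝ) + 2) * ((n i : ℝ) + P.d) * (a₁ i + (bx * (I i).M ^ 2 * ε + ε)) < δc i)
    (he1 : ∀ i ε, 0 < ε → ε ≤ eD i → (4 * 1 * (2 * (I i).M ^ 5 * hst * cJ / γ) + bx * (I i).M ^ 2) * ε < a₁ i) :
    B15.Prop1Printed (lfVarOn su2Chart I) := by

  have hd : 2 ≤ P.d := by omega
  have hN3 : ∀ i κ, hi i κ - lo i κ + 3 < (P.sitesPerDir (I i).k : ℤ) := fun i κ => by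
    have h5 := hN5 i κ
    have hle : lo i κ ≤ hi i κ := hlohi i κ
    rw [Int.toNat_of_nonneg (by linarith)] at h5
    linarith
  refine prop1Printed_lfVarOn_su2_box_G0_of_17 hd h0 I T H Hst hadj Δ₁ dV J lo hi n hn hN hbox hZ hTG0 hN5 K hK1 hKn ext
    hγ hγ₀ hh₁ hhst hcJ hbx hℓ hr heA heD hδc ha₁ hM h17 hsm hγle hH hHst hdV0 hdV hρ hsmall hA hJ hc3 hc3'' hAn hdom
    ?_ ?_ ?_ hN' hδ he1
  · -- hext0: *"equal to the given one on Z∩Λ^c"*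
    intro i Vk
    rw [hext]
    exact extend_mem_extSet _ _ _
  · -- hextZ: every plaquette of `Z^{(k)}`
    intro i ε Vk hε _ hreg p hp
    rw [hext]
    exact ((dist1_plaqHol_extend_shellGauge_le hd3 (hlohi i) (hn i) (hN3 i) (hbox i) (hZ i) hε hreg).1 p hp).trans
      (mul_le_mul_of_nonneg_right (hbxM i) hε.le)
  · -- hextΛ: every plaquette meeting `Λ^{(k)}`
    intro i ε Vk hε hreg p hp
    rw [hext]
    exact ((dist1_plaqHol_extend_shellGauge_le hd3 (hlohi i) (hn i) (hN3 i) (hbox i) (hZ i) hε hreg).2 p hp).trans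
      (mul_le_mul_of_nonneg_right (hbxM i) hε.le)

/-! ## §3 The thresholds are jointly satisfiable (non-vacuity service for the audit A2) -/

/-- **THE THREE THRESHOLDS `hN'` ∕ `hδ` ∕ `he1` OF `prop1Printed_lfVarOn_su2_box_G0_of_17(_ext193)` ARE JOINTLY SATISFIABLE**
(*"ε > 0 is sufficiently small"*, p. 193; *"mild regularity conditions, e.g., |∂V_k − 1| < a₁"*, p. 194): for every radius
`r > 0`, free-bond count `N`, `γ > 0`, `M ≥ 1`, `hst, cJ, bx ≥ 0`, side bound `n` and dimension `d` there are `δc, a₁, eD > 0`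
with `√N·(π/2)·δc ≤ r`, `(n+2)(n+d)(a₁ + (bx M² ε + ε)) < δc` and `(4·(2M⁵ hst cJ/γ) + bx M²)·ε < a₁` for all `0 < ε ≤ eD`
(explicitly `δc = r/(√N·π/2 + 1)`, `a₁ = δc/(4((n+2)(n+d) + 1))`, `eD` the smaller of two explicit quotients).
[cite: Balaban1989LargeFieldI, p.193, Prop. 1 (1.77) p.194] -/
theorem thresholds_exist {r γ M hst cJ bx : ℝ} (N : ℝ) (hr : 0 < r) (hγ : 0 < γ) (hM : 1 ≤ M)
    (hhst : 0 ≤ hst) (hcJ : 0 ≤ cJ) (hbx : 0 ≤ bx) (n d : ℕ) :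
    ∃ δc a₁ eD : ℝ, 0 < δc ∧ 0 < a₁ ∧ 0 < eD ∧ Real.sqrt N * (π / 2 * δc) ≤ r ∧
      (∀ ε : ℝ, 0 < ε → ε ≤ eD → ((n : ℝ) + 2) * ((n : ℝ) + d) * (a₁ + (bx * M ^ 2 * ε + ε)) < δc) ∧
      ∀ ε : ℝ, 0 < ε → ε ≤ eD → (4 * 1 * (2 * M ^ 5 * hst * cJ / γ) + bx * M ^ 2) * ε < a₁ := by
  have hM0 : 0 ≤ M := by linarith
  have hN' : 0 ≤ Real.sqrt N := Real.sqrt_nonneg N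
  set S : ℝ := Real.sqrt N * (π / 2) with hS
  have hS0 : 0 ≤ S := by positivity
  set A : ℝ := ((n : ℝ) + 2) * ((n : ℝ) + d) with hA
  have hA0 : 0 ≤ A := by positivity
  set B : ℝ := 4 * 1 * (2 * M ^ 5 * hst * cJ / γ) + bx * M ^ 2 with hB
  have hB0 : 0 ≤ B := by positivity
  set C : ℝ := bx * M ^ 2 + 1 with hC
  have hC0 : 0 < C := by positivity
  set δc : ℝ := r / (S + 1) with hδc
  have hδc0 : 0 < δc := by positivity
  set a₁ : ℝ := δc / (4 * (A + 1)) with ha₁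
  have ha₁0 : 0 < a₁ := by positivity
  set eD : ℝ := min (a₁ / (2 * (B + 1))) (δc / (4 * (A + 1) * C)) with heD
  have heD0 : 0 < eD := lt_min (by positivity) (by positivity)
  have hA1 : (A + 1) ≠ 0 := (by positivity : (0 : ℝ) < A + 1).ne'
  have hB1 : (B + 1) ≠ 0 := (by positivity : (0 : ℝ) < B + 1).ne'
  have hC1 : C ≠ 0 := hC0.ne'
  have hS1 : (S + 1) ≠ 0 := (by positivity : (0 : ℝ) < S + 1).ne'
  refine ⟨δc, a₁, eD, hδc0, ha₁0, heD0, ?_, ?_, ?_⟩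
  · -- `√N·(π/2)·δc = S·r/(S + 1) ≤ r`
    have hSr : S * δc ≤ r := by
      rw [hδc, mul_div_assoc', div_le_iff₀ (by positivity)]
      nlinarith
    calc Real.sqrt N * (π / 2 * δc) = S * δc := by rw [hS]; ring
      _ ≤ r := hSr
  · intro ε hε hεD
    have h1 : ε ≤ δc / (4 * (A + 1) * C) := hεD.trans (min_le_right _ _)
    have h2 : bx * M ^ 2 * ε + ε = C * ε := by rw [hC]; ring
    have h3 : (A + 1) * a₁ = δc / 4 := by rw [ha₁]; field_simp
    have h4 : (A + 1) * (C * ε) ≤ δc / 4 := by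
      have h := mul_le_mul_of_nonneg_left h1 (by positivity : (0 : ℝ) ≤ (A + 1) * C)
      calc (A + 1) * (C * ε) = (A + 1) * C * ε := by ring
        _ ≤ (A + 1) * C * (δc / (4 * (A + 1) * C)) := h
        _ = δc / 4 := by field_simp
    rw [h2]
    calc A * (a₁ + C * ε) ≤ (A + 1) * (a₁ + C * ε) :=
          mul_le_mul_of_nonneg_right (by linarith) (by positivity)
      _ = (A + 1) * a₁ + (A + 1) * (C * ε) := by ring
      _ ≤ δc / 4 + δc / 4 := add_le_add h3.le h4
      _ < δc := by linarith
  · intro ε hε hεD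
    have h1 : ε ≤ a₁ / (2 * (B + 1)) := hεD.trans (min_le_left _ _)
    calc B * ε ≤ (B + 1) * ε := mul_le_mul_of_nonneg_right (by linarith) hε.le
      _ ≤ (B + 1) * (a₁ / (2 * (B + 1))) := mul_le_mul_of_nonneg_left h1 (by positivity)
      _ = a₁ / 2 := by field_simp
      _ < a₁ := by linarith

end Literature.MathematicalPhysics.QuantumFieldTheory.Balaban1983to89.B15Prop1CarrierOnSU2BoxExt193

end
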